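import Summits.CriticalPhenomena.CardyFormulaZ2.Theorems.StripClusterRates.Negative.KacFromAboveFalse
import Literature.Probability.Percolation.InequalitiesProofs
import Literature.Probability.Percolation.LocalEvents
import Literature.Probability.Percolation.RSWProofs

/-!
# BK–Reimer three-arm bound for the two-cluster event: the probability estimate (stub R2)

Crux `Summit.CriticalPhenomena.CardyFormulaZ2.Theses.CardyBoundaryCoulombGas.StripClusterRates`
(stmt-CriticalPhenomena-13878), line `two-cluster-rate-is-stationary-gap`, stub
`arm_real_threeArm_le` of the BK–Reimer three-arm bound `p₂(m,n) ≤ p₁(m,n)² · p₁(m+1,n-1)` for the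
LOWER edge of the two-cluster window.

For bond percolation on `ℤ²` at `p = 1/2` and the rectangle `[0, m] × [0, n]`, `n ≥ 1`, write
`LR = lrCrossing m n`, `TB = tbCrossing m n`. The two-cluster event lies in the disjoint occurrence
`LR □ (LR □ TBᶜ)` (the lead's event inclusion, not used here); this file bounds its probability:

* Reimer's inequality (`reimer_holds`, arbitrary local events) twice:
  `P(LR □ (LR □ TBᶜ)) ≤ P(LR) · P(LR □ TBᶜ) ≤ P(LR) · P(LR) · P(TBᶜ)`,
  the three events being local (`PlanarDuality.determinedBy_openCrossing`: both crossing events of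
  the rectangle are determined by its vertex pairs, hence so are `TBᶜ` and `LR □ TBᶜ`,
  `DeterminedBy.compl`, `DeterminedBy.disjointOccurrence`);
* the values: `P(LR) = crossingProb ½ m n` by definition, `P(TB) = crossingProb ½ n m`
  (`real_tbCrossing`), and `1 - crossingProb ½ n m = crossingProb ½ (m+1) (n-1)` by duality at the
  self-dual point (`crossingProb_add_crossingProb_symm_holds`, `symm_half`).

Sources: Reimer, *Combin. Probab. Comput.* 9 (2000) 27–32 (main theorem; in the tree as
`reimer_holds`); Bollobás–Riordan, *Percolation* (2006), Ch. 3, Corollary 3(i) (duality, in the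
tree). No named unproved facts are used.
-/

noncomputable section

open MeasureTheory Filter Topology
open Literature.Probability.LatticeModels Literature.Probability.Percolation
open scoped Literature.Probability.Percolation

namespace Summit.CriticalPhenomena.CardyFormulaZ2.Cruxes.StripClusterRates.TwoClusterRateIsStationaryGap

/-- The event `LR(m, n) □ (TB(m, n))ᶜ` ("an open left-right crossing of `[0, m] × [0, n]` occurring
disjointly from the absence of an open top-bottom crossing") is determined by the vertex pairs of
the rectangle, hence is a local event. [folklore] -/
theorem arm2_isLocalEvent_lrCrossing_disjointOccurrence_compl_tbCrossing (m n : ℕ) :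
    IsLocalEvent (lrCrossing m n □ (tbCrossing m n)ᶜ) :=
  ⟨(rectangle m n).sym2,
    (PlanarDuality.determinedBy_openCrossing (rectangle m n) _ _).disjointOccurrence
      (PlanarDuality.determinedBy_openCrossing (rectangle m n) _ _).compl⟩

/-- At the self-dual point, the probability that `[0, m] × [0, n]` (`n ≥ 1`) has NO open
top-bottom crossing is the crossing probability of the `(m+1) × (n-1)` rectangle:
`P_½(TB(m, n)ᶜ) = 1 - crossingProb ½ n m = crossingProb ½ (m+1) (n-1)` (transposition symmetry
`real_tbCrossing` and duality `crossingProb_add_crossingProb_symm_holds` with `symm_half`).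
[folklore] -/
theorem arm2_real_compl_tbCrossing (m n : ℕ) (hn : 1 ≤ n) :
    (bondPercolation (zdGraph 2) half).real (tbCrossing m n)ᶜ =
      crossingProb half (m + 1) (n - 1) := by
  rw [probReal_compl_eq_one_sub (measurableSet_tbCrossing m n), real_tbCrossing half n m]
  have hdual := crossingProb_add_crossingProb_symm_holds half m (n - 1)
  rw [symm_half, Nat.sub_add_cancel hn] at hdual
  linarith

/-- **BK–Reimer three-arm bound, probability estimate.** For bond percolation on `ℤ²` at
`p = 1/2` and `n ≥ 1`,
`P_½(LR(m,n) □ (LR(m,n) □ TB(m,n)ᶜ)) ≤ crossingProb ½ m n ^ 2 · crossingProb ½ (m+1) (n-1)`: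
Reimer's inequality twice (`reimer_holds`, all three events local), then
`P(LR) = crossingProb ½ m n` and `P(TBᶜ) = crossingProb ½ (m+1) (n-1)` (self-duality).
[cite: ReimerCPC2000, main theorem] -/
theorem arm_real_threeArm_le : ∀ m n : ℕ, 1 ≤ n → (bondPercolation (zdGraph 2) half).real (disjointOccurrence (lrCrossing m n) (disjointOccurrence (lrCrossing m n) (tbCrossing m n)ᶜ)) ≤ crossingProb half m n ^ 2 * crossingProb half (m + 1) (n - 1) := by
  intro m n hn
  have hLRl : IsLocalEvent (lrCrossing m n) := isLocalEvent_lrCrossing m n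
  have hTBcl : IsLocalEvent (tbCrossing m n)ᶜ := (isLocalEvent_tbCrossing m n).compl
  have h2l := arm2_isLocalEvent_lrCrossing_disjointOccurrence_compl_tbCrossing m n
  -- Reimer's inequality, twice
  have h1 : (bondPercolation (zdGraph 2) half).real
      (lrCrossing m n □ (lrCrossing m n □ (tbCrossing m n)ᶜ)) ≤
      (bondPercolation (zdGraph 2) half).real (lrCrossing m n) *
        (bondPercolation (zdGraph 2) half).real (lrCrossing m n □ (tbCrossing m n)ᶜ) :=
    reimer_holds (zdGraph 2) half hLRl h2l
  have h2 : (bondPercolation (zdGraph 2) half).real (lrCrossing m n □ (tbCrossing m n)ᶜ) ≤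
      (bondPercolation (zdGraph 2) half).real (lrCrossing m n) *
        (bondPercolation (zdGraph 2) half).real (tbCrossing m n)ᶜ :=
    reimer_holds (zdGraph 2) half hLRl hTBcl
  -- the values of the three factors
  have hLR : (bondPercolation (zdGraph 2) half).real (lrCrossing m n) = crossingProb half m n := rfl
  rw [arm2_real_compl_tbCrossing m n hn] at h2
  rw [hLR] at h1 h2
  have h0 : 0 ≤ crossingProb half m n := (crossingProb_mem_Icc half m n).1
  calc (bondPercolation (zdGraph 2) half).real
        (lrCrossing m n □ (lrCrossing m n □ (tbCrossing m n)ᶜ))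
      ≤ crossingProb half m n *
          (bondPercolation (zdGraph 2) half).real (lrCrossing m n □ (tbCrossing m n)ᶜ) := h1
    _ ≤ crossingProb half m n * (crossingProb half m n * crossingProb half (m + 1) (n - 1)) :=
        mul_le_mul_of_nonneg_left h2 h0
    _ = crossingProb half m n ^ 2 * crossingProb half (m + 1) (n - 1) := by ring

end Summit.CriticalPhenomena.CardyFormulaZ2.Cruxes.StripClusterRates.TwoClusterRateIsStationaryGap

end
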